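import Literature.Algebra.EuclideanLattices.MRThm59AttemptMachine
import HarnessLib

/-!
# `owfExist_of_gapSVP_worstCaseHard` holds

Topic `Computability/Cryptography` (family `pqc`). Discharge of the named fact
`Literature.Computability.Cryptography.owfExist_of_gapSVP_worstCaseHard` (`LatticeOWF.lean`: worst-case
hardness of `GapSVP` within Micciancio–Regev's factor gives one-way functions) along the verifier-free route:
MR07 Thm. 5.23's first step — Cor. 5.13 = Thm. 5.9 iterated by the loop of Lemma 5.10 — run on the integral
dual lattice at machine level (`MRLemma510*`, `MRThm59Shell`), the single attempt of Thm. 5.9 being the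
machine of `MRThm59AttemptMachine.H59a_holds` (fine-grid sampling `DualGridAttemptSuccess`, guessed-coin
oracle call, `MRThm59Attempt.attempt_success_of_law`), and Ajtai's function (`SISFunction*`). This file is a
sibling of `LatticeOWFProofs.lean` (which cannot import the machine files without an import cycle).

## References

* D. Micciancio, O. Regev, *Worst-case to average-case reductions based on Gaussian measures*,
  SIAM J. Comput. 37 (2007) 267–302; authors' version, Thm. 5.23 (proof, first step, p. 29), Cor. 5.13,
  Lemma 5.10, Thm. 5.9 [MicciancioRegev2007].
* M. Ajtai, *Generating hard instances of lattice problems*, STOC 1996, Thm. 1 [Ajtai1996].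
-/

namespace Literature.Computability.Cryptography

/-- **`owfExist_of_gapSVP_worstCaseHard` holds**: worst-case hardness of `GapSVP_γ`, `γ = max 1 (14π√n β)`,
for promise-`BPP` on a set of dimensions meeting every cofinite set gives a one-way function (Micciancio–Regev
2007, Thm. 5.23 with Cor. 5.13, Lemma 5.10, Thm. 5.9, and Ajtai 1996, Thm. 1 — all at machine level).
[cite: MicciancioRegev2007, Thm. 5.23 (proof, first step, p. 29) with Cor. 5.13, Lemma 5.10, Thm. 5.9; Ajtai 1996 Thm. 1] -/
theorem owfExist_of_gapSVP_worstCaseHard_holds : owfExist_of_gapSVP_worstCaseHard :=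
  Literature.Algebra.EuclideanLattices.MRThm59.owfExist_of_gapSVP_worstCaseHard_of_incGDDAttempt
    Literature.Algebra.EuclideanLattices.MRThm59.H59a_holds

end Literature.Computability.Cryptography
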